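import Literature.MathematicalPhysics.QuantumFieldTheory.Balaban1983to89.B3Op116CollarConst

/-!
# Bałaban, *(Higgs)₂,₃ quantum fields in a finite volume III* [B3] — THE COLLAR CONSTANT IS UNIFORM IN THE LATTICE SPACING AND THE SCALE:
`(ε^d)^{−1}·collarK ≤ collarKU(d, L, N, δ, a, C₁, C₂, C₄; |e|s, L^k|e|δ_A, n_F, m, c₁, c₂)` — file «CollarCurrency» (Route δ, the currency step)

statement-level skeleton of published theorems with citation tags; proofs where landed; nothing here is a claim about the Yang–Mills mass gap

T. Bałaban, Commun. Math. Phys. **88** (1983) 411–445 [cite: Balaban1983Higgs3], (1.16) p. 414 (*"uniformly bounded by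
O(1)(e(L^kε)^{1−α})^{n+n′}"*), Prop. 1 pp. 420–421 (*"The constant O(1) … is independent of ε, k, the domains Ω, Ω₁, Ω₂, the vector field B̃"*),
(2.5) p. 424, p. 433 (class (c)); part I [cite: Balaban1982Higgs1], (2.23) p. 610, (3.15) p. 614.

CITATION HEADER (lean-in-tree rule).  Cell `lit-balaban`, Phase-2 proof seat **p40** gen 78 (unit `lit-balaban-p40`,
literature-prover-lit-balaban-p40-g78-0); free-target protocol G.5-34(d) (TAKING HOME/STATUS.md 2026-08-23T19:46:47Z, the `ClassCSplit` glue; this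
file is its CURRENCY companion, answering the lead's (δ3) of HEAD WORD Q35 (HOME/STATUS 2026-08-23T20:13:49Z) as far as the ε- and k-dependence of
the collar constant goes).  Design note `lit-balaban-p40/DESIGN-B3-116-box.md` §8.4, §9.3.  USED BY NAME: p40's `B3Op116CollarConst.collarK` (p371769),
`B3Op116CollarRows.{collarC, farC, faceC, pairC}`, p35's `B3Op116MajorantStep.blkK`, p33's `B3Ineq31SmoothLocalization.smoothConst`, the typer's
`B1.aSeq_le` / `B1.aSeq_pos`.  No head claim; cells B3.Eq2.5 / B3.Txt@433 (owner r15).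

## What this file proves, and how

§1 the `ε`-free parts of the one-scale constants: `pairC = pairC₀·(ε^d)^{−1}`, `faceC = faceC₀·(ε^{d−1})^{−1}`, `farC = farC₀`, `blkK = blkK₀`
(definitional).  §2 `inv_mul_collarC_eq` / `inv_mul_collarC_le`: `(ε^d)^{−1}·collarC(k; c_K, c_K′, c_v, c_d; κ₁, κ₂, κ₃, κ₅, 0, κ₄)` with
dictionary constants `c ≤ ε^d·a` is bounded by the `ε`-FREE, `k`-FREE `collarCU(d, L, N, δ, a_v; a₁…a₄; κ₁, τ, κ₃, κ₅, ω)` as soon as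
`L^kε ≤ 1`, `L^kε·κ₂ ≤ τ`, `L^kε·κ₄ ≤ ω` (every summand of `collarC` carries exactly two dictionary constants and one `pairC`, so the powers of
`ε` cancel identically; the scale enters only through `L^kε ≤ 1`, `(L^kε)^{a′+1−a} ≤ 1` and the two products `L^kε·κ₂`, `L^kε·κ₄`).
§3 `inv_mul_face_le`: the face term of `collarK` likewise (`ε^{2d}·(ε^{d−1})^{−1}·(ε^d)^{−1} = ε` absorbs the `ε^{−1}` of the face charges).
§4 **`collarK_currency`**: for `L > 1`, `1 ≤ k`, `a > 0`, `δ > 0`, `0 ≤ α`, `L^kε ≤ 1`, `s, δ_A, C₁, C₂, C₄, c₁, c₂ ≥ 0`: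
`(ε^d)^{−1}·collarK(k, a, δ, α, s, δ_A, ε^dC₁, ε^dC₁, ε^dC₂, ε^dC₁, ε^dC₁, ε^dC₂, ε^dC₄, ε^dC₄, n_F, m, c₁, c₂)
 ≤ collarKU(d, L, N, δ, a, C₁, C₂, C₄, |e|s, L^k|e|δ_A, n_F, m, c₁, c₂)` — `collarKU` an explicit polynomial, INDEPENDENT of `ε` and of `k`
except through print's smallness parameters `|e|s` (the charge times the size of the collar part) and `L^k|e|δ_A` (the (I.2.23) smallness of its
regularity), using `a_k ≤ a` (`B1.aSeq_le`), `|e|sεd(L^k − 1) ≤ d|e|s·L^kε`, `ε ≤ L^kε ≤ 1`.  Hence the collar members' bound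
`C_G + (ε^d)^{−1}·farF(δ,ρ)·collarK ≤ C_G + farC(δ)·e^{−δρ/4}·collarKU(…)` (`collar_bound_currency`).

## Honest scope

This settles the `ε`- and `k`-UNIFORMITY of the collar constant given the smallness parameters; it does NOT produce print's literal
`O(1)(e(L^kε)p(L^kε))^{n+n′}`: expressing `|e|s`, `L^k|e|δ_A`, `n_F` (≍ `r(L^kε)/K₀` face slices) and `e^{−δρ/4}` (ρ ≍ `r(L^kε)`) through
`e(L^kε)`, `p(L^kε)`, `r(L^kε)` is the caller's regime bookkeeping (p. 433: `|B̃′| ≤ O(r(L^kε)p(L^kε))` on `□`), and the RATE of the members is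
still produced after `(E₀, α, K₀)` (print: `δ₀ = δ₀(d)`), a quantifier order shared with the whole (2.5) lineage.  Definitions are `ε`-free twins of
landed constants plus the explicit polynomial `collarKU`; no `def … : Prop`, no `sorry`; axioms standard.  Value = bookkeeping of a located member of
a by-reference step of B3 — NOT summit progress and nothing about the Yang–Mills mass gap.
-/

noncomputable section

namespace Literature.MathematicalPhysics.QuantumFieldTheory.Balaban1983to89.B3Op116CollarCurrency

open HiggsLattice (ChargeData)
open B1Eq230FluctCov (Ix)
open B1Ineq234Concrete (nCol)
open B3Op116CollarRows (collarC farC faceC pairC farF farC_pos farF_pos)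
open B3Op116MajorantStep (blkK blkK_nonneg)
open B3Ineq31SmoothLocalization (smoothConst smoothConst_pos)
open B3Op116CollarConst (collarK)

variable {P : HiggsLattice.Params} {N : ℕ}

/-! ## §1 The `ε`-free parts of the one-scale constants -/

/-- `pairC₀(d,N,δ) = N_col·(8d/δ)^d`, the `ε`-free part of p33's pair constant (`pairC = pairC₀·(ε^d)^{−1}`). [cite: Balaban1983Higgs3, (2.10) p.426] -/
def pairC₀ (d N : ℕ) (δ : ℝ) : ℝ := (nCol N : ℝ) * (8 * (d : ℝ) / δ) ^ d

/-- `faceC₀(d,δ) = (8d/δ)^{d−1}`, the `ε`-free part of the face pair constant (`faceC = faceC₀·(ε^{d−1})^{−1}`). [cite: Balaban1983Higgs3, (2.10) p.426] -/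
def faceC₀ (d : ℕ) (δ : ℝ) : ℝ := (8 * (d : ℝ) / δ) ^ (d - 1)

/-- `farC₀(d,δ) = (4/δ)^d·d!·(4/δ)` (`= farC`, which never contained `ε`). [cite: Balaban1983Higgs3, (2.10) p.426] -/
def farC₀ (d : ℕ) (δ : ℝ) : ℝ := (4 / δ) ^ d * (d.factorial : ℝ) * (4 / δ)

/-- `blkK₀(d,L,N,δ,a) = e^{δ/2}N_col(4d/(δ/2))^d/(L^a − 1)` (`= blkK`, which never contained `ε`). [cite: Balaban1983Higgs3, (2.10) p.426] -/
def blkK₀ (d : ℕ) (L : ℝ) (N : ℕ) (δ a : ℝ) : ℝ :=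
  Real.exp (δ / 2) * ((nCol N : ℝ) * (4 * (d : ℝ) / (δ / 2)) ^ d) / (L ^ a - 1)

/-- `pairC = pairC₀·(ε^d)^{−1}` (definitional). [cite: Balaban1983Higgs3, (2.10) p.426] -/
theorem pairC_eq (δ : ℝ) : pairC P N δ = pairC₀ P.d N δ * (P.mesh 0 ^ P.d)⁻¹ := rfl

/-- `faceC = faceC₀·(ε^{d−1})^{−1}` (definitional). [cite: Balaban1983Higgs3, (2.10) p.426] -/
theorem faceC_eq (δ : ℝ) : faceC P δ = faceC₀ P.d δ * (P.mesh 0 ^ (P.d - 1))⁻¹ := rfl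

/-- `farC = farC₀` (definitional). [cite: Balaban1983Higgs3, (2.10) p.426] -/
theorem farC_eq (δ : ℝ) : farC P δ = farC₀ P.d δ := rfl

/-- `blkK = blkK₀` (definitional). [cite: Balaban1983Higgs3, (2.10) p.426] -/
theorem blkK_eq (δ a : ℝ) : blkK P N δ a = blkK₀ P.d (P.L : ℝ) N δ a := rfl

/-- `pairC₀ ≥ 0` for `δ > 0`. [cite: Balaban1983Higgs3, (2.10) p.426] -/
theorem pairC₀_nonneg (d N : ℕ) {δ : ℝ} (hδ : 0 < δ) : 0 ≤ pairC₀ d N δ := by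
  unfold pairC₀; positivity

/-- `faceC₀ ≥ 0` for `δ > 0`. [cite: Balaban1983Higgs3, (2.10) p.426] -/
theorem faceC₀_nonneg (d : ℕ) {δ : ℝ} (hδ : 0 < δ) : 0 ≤ faceC₀ d δ := by
  unfold faceC₀; positivity

/-- `farC₀ ≥ 0` for `δ > 0`. [cite: Balaban1983Higgs3, (2.10) p.426] -/
theorem farC₀_nonneg (d : ℕ) {δ : ℝ} (hδ : 0 < δ) : 0 ≤ farC₀ d δ := by
  unfold farC₀; positivity

/-- `blkK₀(P.d, P.L, …) ≥ 0` for `δ > 0`, `a > 0`, `L > 1` (it is `blkK`). [cite: Balaban1983Higgs3, (2.10) p.426] -/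
theorem blkK₀_nonneg (hL : 1 < P.L) {δ a : ℝ} (hδ : 0 < δ) (ha : 0 < a) : 0 ≤ blkK₀ P.d (P.L : ℝ) N δ a := by
  rw [← blkK_eq]; exact blkK_nonneg hL hδ ha

/-! ## §2 `(ε^d)^{−1}·collarC` is an `ε`-free combination, bounded `k`-uniformly -/

section CollarC

/-- **`(ε^d)^{−1}·collarC` as an `ε`-free combination**: every summand of `collarC` carries two dictionary constants and one `pairC`, so after
multiplication by `(ε^d)^{−1}` only the quotients `(ε^d)^{−1}c` remain (an identity of real numbers, `ε ≠ 0`). [cite: Balaban1983Higgs3, (2.10) p.426] -/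
theorem inv_mul_collarC_eq (k : ℕ) (δ aK aKd av cK cKd cv cd κ₁ κ₂ κ₃ κ₅ κF κ₄ : ℝ) :
    (P.mesh 0 ^ P.d)⁻¹ * collarC P N k δ aK aKd av cK cKd cv cd κ₁ κ₂ κ₃ κ₅ κF κ₄ =
      (P.d : ℝ) * (κ₁ * (Real.exp 1 * ((P.mesh 0 ^ P.d)⁻¹ * cK)) * (farC₀ P.d δ * ((P.mesh 0 ^ P.d)⁻¹ * cd)) * pairC₀ P.d N (δ / 2))
      + P.mesh k * κ₂ * ((P.d : ℝ) * (((P.mesh 0 ^ P.d)⁻¹ * cK) * (farC₀ P.d δ * ((P.mesh 0 ^ P.d)⁻¹ * cv)) * pairC₀ P.d N (δ / 2)))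
      + (P.d : ℝ) * (κ₁ * ((P.mesh 0 ^ P.d)⁻¹ * cK) * (farC₀ P.d δ * ((P.mesh 0 ^ P.d)⁻¹ * cd)) * pairC₀ P.d N (δ / 2))
      + P.mesh k * ((P.d : ℝ) * (κ₃ * (Real.exp 1 * ((P.mesh 0 ^ P.d)⁻¹ * cK)) * (farC₀ P.d δ * (Real.exp 1 * ((P.mesh 0 ^ P.d)⁻¹ * cv)))
          * pairC₀ P.d N (δ / 2)))
      + P.mesh k ^ (aKd + 1 - aK) * ((P.d : ℝ) * (κ₅ * ((P.mesh 0 ^ P.d)⁻¹ * cKd) * (farC₀ P.d δ * (Real.exp 1 * ((P.mesh 0 ^ P.d)⁻¹ * cv)))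
          * pairC₀ P.d N (δ / 2)))
      + P.mesh k * κF * (((P.mesh 0 ^ P.d)⁻¹ * cK) * (farC₀ P.d δ * ((P.mesh 0 ^ P.d)⁻¹ * cv)) * pairC₀ P.d N (δ / 2))
      + P.mesh k * κ₄ * (((P.mesh 0 ^ P.d)⁻¹ * cK) * (blkK₀ P.d (P.L : ℝ) N δ av * ((P.mesh 0 ^ P.d)⁻¹ * cv)) * pairC₀ P.d N (δ / 2)) := by
  have hE : P.mesh 0 ^ P.d ≠ 0 := (pow_pos (P.mesh_pos 0) _).ne'
  unfold collarC
  rw [pairC_eq, farC_eq, blkK_eq]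
  field_simp

/-- **The `ε`-FREE, `k`-FREE BOUND OF `(ε^d)^{−1}·collarC`**: with `(ε^d)^{−1}c_K ≤ a₁`, `(ε^d)^{−1}c_K′ ≤ a₂`, `(ε^d)^{−1}c_v ≤ a₃`,
`(ε^d)^{−1}c_d ≤ a₄`, `L^kε ≤ 1`, `a′ + 1 − a ≥ 0`, `L^kε·κ₂ ≤ τ`, `L^kε·κ₄ ≤ ω` (the face-leg slot `κ_F = 0`):
`(ε^d)^{−1}·collarC ≤ collarCU`. [cite: Balaban1983Higgs3, (2.10) p.426, (1.16) p.414] -/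
def collarCU (d : ℕ) (L : ℝ) (N : ℕ) (δ av a₁ a₂ a₃ a₄ κ₁ τ κ₃ κ₅ ω : ℝ) : ℝ :=
  (d : ℝ) * (κ₁ * (Real.exp 1 * a₁) * (farC₀ d δ * a₄) * pairC₀ d N (δ / 2))
  + τ * ((d : ℝ) * (a₁ * (farC₀ d δ * a₃) * pairC₀ d N (δ / 2)))
  + (d : ℝ) * (κ₁ * a₁ * (farC₀ d δ * a₄) * pairC₀ d N (δ / 2))
  + (d : ℝ) * (κ₃ * (Real.exp 1 * a₁) * (farC₀ d δ * (Real.exp 1 * a₃)) * pairC₀ d N (δ / 2))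
  + (d : ℝ) * (κ₅ * a₂ * (farC₀ d δ * (Real.exp 1 * a₃)) * pairC₀ d N (δ / 2))
  + ω * (a₁ * (blkK₀ d L N δ av * a₃) * pairC₀ d N (δ / 2))

/-- `collarCU ≥ 0` for nonnegative arguments (`δ > 0`, `a_v > 0`, `L > 1`). [cite: Balaban1983Higgs3, (2.10) p.426] -/
theorem collarCU_nonneg (hL : 1 < P.L) {δ av a₁ a₂ a₃ a₄ κ₁ τ κ₃ κ₅ ω : ℝ} (hδ : 0 < δ) (hav : 0 < av)
    (ha₁ : 0 ≤ a₁) (ha₂ : 0 ≤ a₂) (ha₃ : 0 ≤ a₃) (ha₄ : 0 ≤ a₄) (hκ₁ : 0 ≤ κ₁) (hτ : 0 ≤ τ) (hκ₃ : 0 ≤ κ₃) (hκ₅ : 0 ≤ κ₅)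
    (hω : 0 ≤ ω) : 0 ≤ collarCU P.d (P.L : ℝ) N δ av a₁ a₂ a₃ a₄ κ₁ τ κ₃ κ₅ ω := by
  have hf := farC₀_nonneg P.d hδ
  have hp := pairC₀_nonneg P.d N (half_pos hδ)
  have hb : 0 ≤ blkK₀ P.d (P.L : ℝ) N δ av := blkK₀_nonneg hL hδ hav
  have he : 0 ≤ Real.exp 1 := (Real.exp_pos 1).le
  unfold collarCU
  positivity

/-- see `collarCU`. [cite: Balaban1983Higgs3, (2.10) p.426, (1.16) p.414] -/
theorem inv_mul_collarC_le (hL : 1 < P.L) {k : ℕ} {δ aK aKd av cK cKd cv cd κ₁ κ₂ κ₃ κ₅ κ₄ a₁ a₂ a₃ a₄ τ ω : ℝ}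
    (hδ : 0 < δ) (hav : 0 < av) (hmesh : P.mesh k ≤ 1) (hexp : 0 ≤ aKd + 1 - aK)
    (hcK : 0 ≤ cK) (hcKd : 0 ≤ cKd) (hcv : 0 ≤ cv) (hcd : 0 ≤ cd)
    (h₁ : (P.mesh 0 ^ P.d)⁻¹ * cK ≤ a₁) (h₂ : (P.mesh 0 ^ P.d)⁻¹ * cKd ≤ a₂) (h₃ : (P.mesh 0 ^ P.d)⁻¹ * cv ≤ a₃)
    (h₄ : (P.mesh 0 ^ P.d)⁻¹ * cd ≤ a₄)
    (hκ₁ : 0 ≤ κ₁) (hκ₂ : 0 ≤ κ₂) (hκ₃ : 0 ≤ κ₃) (hκ₅ : 0 ≤ κ₅) (hκ₄ : 0 ≤ κ₄)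
    (hτ : P.mesh k * κ₂ ≤ τ) (hω : P.mesh k * κ₄ ≤ ω) :
    (P.mesh 0 ^ P.d)⁻¹ * collarC P N k δ aK aKd av cK cKd cv cd κ₁ κ₂ κ₃ κ₅ 0 κ₄
      ≤ collarCU P.d (P.L : ℝ) N δ av a₁ a₂ a₃ a₄ κ₁ τ κ₃ κ₅ ω := by
  rw [inv_mul_collarC_eq]
  have hE : 0 ≤ (P.mesh 0 ^ P.d)⁻¹ := inv_nonneg.2 (pow_nonneg (P.mesh_pos 0).le _)
  have b₁ : 0 ≤ (P.mesh 0 ^ P.d)⁻¹ * cK := mul_nonneg hE hcK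
  have b₂ : 0 ≤ (P.mesh 0 ^ P.d)⁻¹ * cKd := mul_nonneg hE hcKd
  have b₃ : 0 ≤ (P.mesh 0 ^ P.d)⁻¹ * cv := mul_nonneg hE hcv
  have b₄ : 0 ≤ (P.mesh 0 ^ P.d)⁻¹ * cd := mul_nonneg hE hcd
  have ha₁ : 0 ≤ a₁ := b₁.trans h₁
  have ha₂ : 0 ≤ a₂ := b₂.trans h₂
  have ha₃ : 0 ≤ a₃ := b₃.trans h₃
  have ha₄ : 0 ≤ a₄ := b₄.trans h₄
  have hf := farC₀_nonneg P.d hδ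
  have hp := pairC₀_nonneg P.d N (half_pos hδ)
  have hb : 0 ≤ blkK₀ P.d (P.L : ℝ) N δ av := blkK₀_nonneg hL hδ hav
  have he : 0 ≤ Real.exp 1 := (Real.exp_pos 1).le
  have hd : (0 : ℝ) ≤ (P.d : ℝ) := Nat.cast_nonneg _
  have hm : 0 ≤ P.mesh k := (P.mesh_pos k).le
  have hmexp : P.mesh k ^ (aKd + 1 - aK) ≤ 1 := Real.rpow_le_one hm hmesh hexp
  have hτ0 : 0 ≤ τ := (mul_nonneg hm hκ₂).trans hτ
  have hω0 : 0 ≤ ω := (mul_nonneg hm hκ₄).trans hω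
  have t1 : (P.d : ℝ) * (κ₁ * (Real.exp 1 * ((P.mesh 0 ^ P.d)⁻¹ * cK)) * (farC₀ P.d δ * ((P.mesh 0 ^ P.d)⁻¹ * cd)) * pairC₀ P.d N (δ / 2))
      ≤ (P.d : ℝ) * (κ₁ * (Real.exp 1 * a₁) * (farC₀ P.d δ * a₄) * pairC₀ P.d N (δ / 2)) := by
    gcongr
  have t2 : P.mesh k * κ₂ * ((P.d : ℝ) * (((P.mesh 0 ^ P.d)⁻¹ * cK) * (farC₀ P.d δ * ((P.mesh 0 ^ P.d)⁻¹ * cv)) * pairC₀ P.d N (δ / 2)))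
      ≤ τ * ((P.d : ℝ) * (a₁ * (farC₀ P.d δ * a₃) * pairC₀ P.d N (δ / 2))) := by
    gcongr
  have t3 : (P.d : ℝ) * (κ₁ * ((P.mesh 0 ^ P.d)⁻¹ * cK) * (farC₀ P.d δ * ((P.mesh 0 ^ P.d)⁻¹ * cd)) * pairC₀ P.d N (δ / 2))
      ≤ (P.d : ℝ) * (κ₁ * a₁ * (farC₀ P.d δ * a₄) * pairC₀ P.d N (δ / 2)) := by
    gcongr
  have t4 : P.mesh k * ((P.d : ℝ) * (κ₃ * (Real.exp 1 * ((P.mesh 0 ^ P.d)⁻¹ * cK)) * (farC₀ P.d δ * (Real.exp 1 * ((P.mesh 0 ^ P.d)⁻¹ * cv)))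
          * pairC₀ P.d N (δ / 2)))
      ≤ 1 * ((P.d : ℝ) * (κ₃ * (Real.exp 1 * a₁) * (farC₀ P.d δ * (Real.exp 1 * a₃)) * pairC₀ P.d N (δ / 2))) := by
    gcongr
  have t5 : P.mesh k ^ (aKd + 1 - aK) * ((P.d : ℝ) * (κ₅ * ((P.mesh 0 ^ P.d)⁻¹ * cKd) * (farC₀ P.d δ * (Real.exp 1 * ((P.mesh 0 ^ P.d)⁻¹ * cv)))
          * pairC₀ P.d N (δ / 2)))
      ≤ 1 * ((P.d : ℝ) * (κ₅ * a₂ * (farC₀ P.d δ * (Real.exp 1 * a₃)) * pairC₀ P.d N (δ / 2))) := by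
    gcongr
  have t6 : P.mesh k * 0 * (((P.mesh 0 ^ P.d)⁻¹ * cK) * (farC₀ P.d δ * ((P.mesh 0 ^ P.d)⁻¹ * cv)) * pairC₀ P.d N (δ / 2)) = 0 := by ring
  have t7 : P.mesh k * κ₄ * (((P.mesh 0 ^ P.d)⁻¹ * cK) * (blkK₀ P.d (P.L : ℝ) N δ av * ((P.mesh 0 ^ P.d)⁻¹ * cv)) * pairC₀ P.d N (δ / 2))
      ≤ ω * (a₁ * (blkK₀ P.d (P.L : ℝ) N δ av * a₃) * pairC₀ P.d N (δ / 2)) := by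
    gcongr
  unfold collarCU
  linarith

end CollarC

/-! ## §3 The face term -/

section Face

/-- **the face term of `collarK` after multiplication by `(ε^d)^{−1}`**: `ε^{2d}·(ε^{d−1})^{−1}·(ε^d)^{−1} = ε` absorbs the `ε^{−1}` of the
face charges; with `|e|δ_A ≤ τ` and `ε ≤ 1`:
`(ε^d)^{−1}·[n_F·d·((ε^{−1}|e|δ_A + ε^{−1}|e|s) + (3ε^{−1}|e|s + 2(|e|s)²))·(ε^dC_H·(farC·ε^dC)·faceC(δ/2))] ≤ n_F·d·((τ + |e|s) + (3|e|s + 2(|e|s)²))·(C_H·(farC₀·C)·faceC₀(δ/2))`.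
[cite: Balaban1983Higgs3, (2.10) p.426, (2.11) p.426] -/
theorem inv_mul_face_le {δ es eδ τ CH C₁ : ℝ} (nF : ℕ) (hδ : 0 < δ) (heτ : eδ ≤ τ) (hε1 : P.mesh 0 ≤ 1)
    (hCH : 0 ≤ CH) (hC₁ : 0 ≤ C₁) :
    (P.mesh 0 ^ P.d)⁻¹ * ((nF : ℝ) * P.d * (((P.mesh 0)⁻¹ * eδ + (P.mesh 0)⁻¹ * es) + (3 * ((P.mesh 0)⁻¹ * es) + 2 * es ^ 2)) *
        ((P.mesh 0 ^ P.d * CH) * (farC P δ * (P.mesh 0 ^ P.d * C₁)) * faceC P (δ / 2)))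
      ≤ (nF : ℝ) * P.d * ((τ + es) + (3 * es + 2 * es ^ 2)) * (CH * (farC₀ P.d δ * C₁) * faceC₀ P.d (δ / 2)) := by
  have hε := P.mesh_pos 0
  have hsplit : P.mesh 0 ^ P.d = P.mesh 0 ^ (P.d - 1) * P.mesh 0 := by
    rw [← pow_succ, Nat.sub_add_cancel P.hd]
  have hEd1 : P.mesh 0 ^ (P.d - 1) ≠ 0 := (pow_pos hε _).ne'
  have hid : (P.mesh 0 ^ P.d)⁻¹ * ((nF : ℝ) * P.d * (((P.mesh 0)⁻¹ * eδ + (P.mesh 0)⁻¹ * es) + (3 * ((P.mesh 0)⁻¹ * es) + 2 * es ^ 2)) *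
        ((P.mesh 0 ^ P.d * CH) * (farC P δ * (P.mesh 0 ^ P.d * C₁)) * faceC P (δ / 2)))
      = (nF : ℝ) * P.d * ((eδ + es) + (3 * es + 2 * es ^ 2 * P.mesh 0)) * (CH * (farC₀ P.d δ * C₁) * faceC₀ P.d (δ / 2)) := by
    rw [faceC_eq, farC_eq, hsplit]
    field_simp
  rw [hid]
  have hf := farC₀_nonneg P.d hδ
  have hfc := faceC₀_nonneg P.d (half_pos hδ)
  have hd : (0 : ℝ) ≤ (P.d : ℝ) := Nat.cast_nonneg _
  have hn : (0 : ℝ) ≤ (nF : ℝ) := Nat.cast_nonneg _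
  have hin : (eδ + es) + (3 * es + 2 * es ^ 2 * P.mesh 0) ≤ (τ + es) + (3 * es + 2 * es ^ 2) := by
    nlinarith [sq_nonneg es]
  gcongr

end Face

/-! ## §4 The uniform bound of the explicit collar constant -/

section Main

/-- **THE `ε`-FREE, `k`-FREE MAJORANT `collarKU` OF `(ε^d)^{−1}·collarK`** — an explicit polynomial in the dictionary constants `C₁, C₂, C₄`,
the charge-times-size `|e|s` of the collar part, its (I.2.23) smallness `τ = L^k|e|δ_A`, the face count `n_F`, the bump data and `a, δ, d, L, N`
(the eight `collarC` instances of `collarK` through `collarCU`, the two face terms through §3). [cite: Balaban1983Higgs3, (1.16) p.414, (2.5) p.424, p.433] -/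
def collarKU (d : ℕ) (L : ℝ) (N : ℕ) (δ a C₁ C₂ C₄ es τ : ℝ) (nF m : ℕ) (c₁ c₂ : ℝ) : ℝ :=
  smoothConst d m c₁ (c₂ + 2 * c₁) *
    ((collarCU d L N δ 2 C₁ C₁ C₁ (C₁ + Real.exp 1 * C₁ * es) es 0 (es ^ 2) es (a * ((es * d) * (2 + es * d)))
      + collarCU d L N δ 2 C₁ (C₁ + Real.exp 1 * C₁ * es) C₁ C₁ es 0 (es ^ 2) es (a * ((es * d) * (2 + es * d))))
    + (collarCU d L N δ 2 C₁ C₂ C₁ (C₁ + Real.exp 1 * C₁ * es) es 0 (es ^ 2) es (a * ((es * d) * (2 + es * d)))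
      + collarCU d L N δ 2 C₁ (C₂ + Real.exp 1 * C₁ * (es * (Fintype.card (Ix N) : ℝ))) C₁ C₁ es 0 (es ^ 2) es
          (a * ((es * d) * (2 + es * d)))))
  + ((2 * (collarCU d L N δ 2 C₁ C₂ C₁ (C₁ + Real.exp 1 * C₁ * es) es 0 (es ^ 2) es (a * ((es * d) * (2 + es * d)))
        + collarCU d L N δ 2 C₁ (C₂ + Real.exp 1 * C₁ * (es * (Fintype.card (Ix N) : ℝ))) C₁ C₁ es 0 (es ^ 2) es
          (a * ((es * d) * (2 + es * d))))
      + ((2 * collarCU d L N δ 2 C₄ 0 C₁ (C₁ + Real.exp 1 * C₁ * es) es τ (es ^ 2) 0 (a * ((es * d) * (2 + es * d)))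
          + 2 * ((nF : ℝ) * d * ((τ + es) + (3 * es + 2 * es ^ 2)) * (C₄ * (farC₀ d δ * C₁) * faceC₀ d (δ / 2))))
        + (2 * collarCU d L N δ 2 C₄ 0 C₁ C₁ es τ (es ^ 2) 0 (a * ((es * d) * (2 + es * d)))
          + 2 * ((nF : ℝ) * d * ((τ + es) + (3 * es + 2 * es ^ 2)) * (C₄ * (farC₀ d δ * C₁) * faceC₀ d (δ / 2))))))
    + (d : ℝ) * m * (collarCU d L N δ 1 C₁ C₂ ((Fintype.card (Ix N) : ℝ) * C₁) (C₂ + Real.exp 1 * C₁ * (es * (Fintype.card (Ix N) : ℝ)))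
          es 0 (es ^ 2) es (a * ((es * d) * (2 + es * d)))
      + collarCU d L N δ 1 C₁ (C₂ + Real.exp 1 * C₁ * (es * (Fintype.card (Ix N) : ℝ))) ((Fintype.card (Ix N) : ℝ) * C₁) C₂
          es 0 (es ^ 2) es (a * ((es * d) * (2 + es * d)))))

/-- linear recombination of the twelve term bounds along the shape of `collarK` (plumbing). [folklore] -/
private theorem combine {E S c1 c2 c3 c4 c5 c6 c7 c8 c9 c10 F1 F2 U1 U2 U3 U4 U5 U6 U7 U8 U9 U10 G1 G2 dm : ℝ}
    (hS : 0 ≤ S) (hdm : 0 ≤ dm)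
    (h1 : E * c1 ≤ U1) (h2 : E * c2 ≤ U2) (h3 : E * c3 ≤ U3) (h4 : E * c4 ≤ U4) (h5 : E * c5 ≤ U5) (h6 : E * c6 ≤ U6)
    (h7 : E * c7 ≤ U7) (h8 : E * c8 ≤ U8) (h9 : E * c9 ≤ U9) (h10 : E * c10 ≤ U10) (f1 : E * F1 ≤ G1) (f2 : E * F2 ≤ G2) :
    E * (S * (c1 + c2 + (c3 + c4)) + (2 * (c5 + c6) + ((2 * c7 + 2 * F1) + (2 * c8 + 2 * F2)) + dm * (c9 + c10)))
      ≤ S * (U1 + U2 + (U3 + U4)) + (2 * (U5 + U6) + ((2 * U7 + 2 * G1) + (2 * U8 + 2 * G2)) + dm * (U9 + U10)) := by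
  have hA : S * (E * c1) + S * (E * c2) + (S * (E * c3) + S * (E * c4)) ≤ S * U1 + S * U2 + (S * U3 + S * U4) :=
    add_le_add (add_le_add (mul_le_mul_of_nonneg_left h1 hS) (mul_le_mul_of_nonneg_left h2 hS))
      (add_le_add (mul_le_mul_of_nonneg_left h3 hS) (mul_le_mul_of_nonneg_left h4 hS))
  have h910 : dm * (E * c9) + dm * (E * c10) ≤ dm * U9 + dm * U10 :=
    add_le_add (mul_le_mul_of_nonneg_left h9 hdm) (mul_le_mul_of_nonneg_left h10 hdm)
  linarith [hA, h910]

set_option maxHeartbeats 800000 in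
/-- **THE COLLAR CONSTANT IS UNIFORM IN `ε` AND `k`**: for `L > 1`, `1 ≤ k`, `a > 0`, `δ > 0`, `0 ≤ α`, `L^kε ≤ 1` and nonnegative data,
`(ε^d)^{−1}·collarK(k, a, δ, α, s, δ_A, ε^dC₁, ε^dC₁, ε^dC₂, ε^dC₁, ε^dC₁, ε^dC₂, ε^dC₄, ε^dC₄, n_F, m, c₁, c₂) ≤ collarKU(d, L, N, δ, a, C₁, C₂, C₄, |e|s, L^k|e|δ_A, n_F, m, c₁, c₂)`
(generous heartbeats: ten `collarC` instances). [cite: Balaban1983Higgs3, (1.16) p.414 «uniformly bounded», Prop. 1 p.421 «independent of ε, k», (2.5) p.424, p.433] [cite: Balaban1982Higgs1, (2.23) p.610, (3.15) p.614] -/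
theorem collarK_currency (hL : 1 < P.L) (C : ChargeData N) {k : ℕ} (hk : 1 ≤ k) {a δ α s δA C₁ C₂ C₄ c₁ c₂ : ℝ} (ha : 0 < a)
    (hδ : 0 < δ) (hα : 0 ≤ α) (hmesh : P.mesh k ≤ 1) (hs : 0 ≤ s) (hδA : 0 ≤ δA) (hC₁ : 0 ≤ C₁) (hC₂ : 0 ≤ C₂) (hC₄ : 0 ≤ C₄)
    (hc₁ : 0 ≤ c₁) (hc₂ : 0 ≤ c₂) (nF m : ℕ) :
    (P.mesh 0 ^ P.d)⁻¹ * collarK P N C k a δ α s δA (P.mesh 0 ^ P.d * C₁) (P.mesh 0 ^ P.d * C₁) (P.mesh 0 ^ P.d * C₂) (P.mesh 0 ^ P.d * C₁)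
        (P.mesh 0 ^ P.d * C₁) (P.mesh 0 ^ P.d * C₂) (P.mesh 0 ^ P.d * C₄) (P.mesh 0 ^ P.d * C₄) nF m c₁ c₂
      ≤ collarKU P.d (P.L : ℝ) N δ a C₁ C₂ C₄ (|C.e| * s) ((P.L : ℝ) ^ k * (|C.e| * δA)) nF m c₁ c₂ := by
  -- abbreviations and signs
  have hε := P.mesh_pos 0
  have hE := pow_pos hε P.d
  have hEne : P.mesh 0 ^ P.d ≠ 0 := hE.ne'
  have hEi : 0 ≤ (P.mesh 0 ^ P.d)⁻¹ := inv_nonneg.2 hE.le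
  have hL1 : (1 : ℝ) ≤ (P.L : ℝ) := by exact_mod_cast hL.le
  have hLk : (1 : ℝ) ≤ (P.L : ℝ) ^ k := one_le_pow₀ hL1
  have hmk : P.mesh k = (P.L : ℝ) ^ k * P.mesh 0 := by
    have h := B3Op116CollarRows.mesh_eq_pow_mul_mesh (P := P) (Nat.zero_le k); rwa [Nat.sub_zero] at h
  have hm : 0 ≤ P.mesh k := (P.mesh_pos k).le
  have hε1 : P.mesh 0 ≤ 1 := by
    have : P.mesh 0 ≤ P.mesh k := by rw [hmk]; exact le_mul_of_one_le_left hε.le hLk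
    exact this.trans hmesh
  have hes : 0 ≤ |C.e| * s := mul_nonneg (abs_nonneg _) hs
  have heδ : 0 ≤ |C.e| * δA := mul_nonneg (abs_nonneg _) hδA
  have he1 : 0 ≤ Real.exp 1 := (Real.exp_pos 1).le
  have hNC : 0 ≤ (Fintype.card (Ix N) : ℝ) := Nat.cast_nonneg _
  have hd : (0 : ℝ) ≤ (P.d : ℝ) := Nat.cast_nonneg _
  have hmn : (0 : ℝ) ≤ (m : ℝ) := Nat.cast_nonneg _
  -- the dictionary slots: `(ε^d)^{−1}(ε^d C) = C`, and the two `L^kε`-carrying ones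
  have q : ∀ X : ℝ, (P.mesh 0 ^ P.d)⁻¹ * (P.mesh 0 ^ P.d * X) = X := fun X => by field_simp
  have q₁ : (P.mesh 0 ^ P.d)⁻¹ * (P.mesh 0 ^ P.d * C₁) ≤ C₁ := (q C₁).le
  have q₂ : (P.mesh 0 ^ P.d)⁻¹ * (P.mesh 0 ^ P.d * C₂) ≤ C₂ := (q C₂).le
  have q₄ : (P.mesh 0 ^ P.d)⁻¹ * (P.mesh 0 ^ P.d * C₄) ≤ C₄ := (q C₄).le
  have q0 : (P.mesh 0 ^ P.d)⁻¹ * (0 : ℝ) ≤ 0 := by rw [mul_zero]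
  have qN : (P.mesh 0 ^ P.d)⁻¹ * ((Fintype.card (Ix N) : ℝ) * (P.mesh 0 ^ P.d * C₁)) ≤ (Fintype.card (Ix N) : ℝ) * C₁ := by
    rw [mul_left_comm, q]
  have qd : (P.mesh 0 ^ P.d)⁻¹ * (P.mesh 0 ^ P.d * C₁ + Real.exp 1 * (P.mesh 0 ^ P.d * C₁) * P.mesh k * (|C.e| * s))
      ≤ C₁ + Real.exp 1 * C₁ * (|C.e| * s) := by
    have h1 : (P.mesh 0 ^ P.d)⁻¹ * (P.mesh 0 ^ P.d * C₁ + Real.exp 1 * (P.mesh 0 ^ P.d * C₁) * P.mesh k * (|C.e| * s))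
        = C₁ + Real.exp 1 * C₁ * (|C.e| * s) * P.mesh k := by field_simp
    rw [h1]
    nlinarith [mul_nonneg (mul_nonneg he1 hC₁) hes]
  have qm : (P.mesh 0 ^ P.d)⁻¹ * (P.mesh 0 ^ P.d * C₂ + Real.exp 1 * (P.mesh 0 ^ P.d * C₁) * P.mesh k * ((|C.e| * s) * (Fintype.card (Ix N) : ℝ)))
      ≤ C₂ + Real.exp 1 * C₁ * ((|C.e| * s) * (Fintype.card (Ix N) : ℝ)) := by
    have h1 : (P.mesh 0 ^ P.d)⁻¹ * (P.mesh 0 ^ P.d * C₂ + Real.exp 1 * (P.mesh 0 ^ P.d * C₁) * P.mesh k * ((|C.e| * s) * (Fintype.card (Ix N) : ℝ)))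
        = C₂ + Real.exp 1 * C₁ * ((|C.e| * s) * (Fintype.card (Ix N) : ℝ)) * P.mesh k := by field_simp
    rw [h1]
    nlinarith [mul_nonneg (mul_nonneg (mul_nonneg he1 hC₁) hes) hNC]
  -- the two scale-carrying charges: `L^kε·(ε^{−1}|e|δ_A) = L^k|e|δ_A` and the averaging charge `L^kε·κ₄ ≤ a|e|sd(2 + |e|sd)`
  have hτ : P.mesh k * ((P.mesh 0)⁻¹ * (|C.e| * δA)) ≤ (P.L : ℝ) ^ k * (|C.e| * δA) := by
    rw [hmk]; field_simp; exact le_rfl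
  have hτ0 : P.mesh k * (0 : ℝ) ≤ 0 := by rw [mul_zero]
  have hak0 : 0 < B1.aSeq a P.L k := B1.aSeq_pos ha (by exact_mod_cast hL) hk
  have hak : |B1.aSeq a P.L k| ≤ a := by rw [abs_of_pos hak0]; exact B1.aSeq_le ha (by exact_mod_cast hL) k hk
  have hmε : |C.e| * s * P.mesh 0 * (P.d * ((P.L : ℝ) ^ k - 1)) ≤ |C.e| * s * P.d * P.mesh k := by
    rw [hmk]; nlinarith [mul_nonneg hes (mul_nonneg hd hε.le)]
  have hmε0 : 0 ≤ |C.e| * s * P.mesh 0 * (P.d * ((P.L : ℝ) ^ k - 1)) :=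
    mul_nonneg (mul_nonneg hes hε.le) (mul_nonneg hd (by linarith))
  have hκ₄0 : 0 ≤ |B1.aSeq a P.L k| * (P.mesh k)⁻¹ ^ 2 *
      ((|C.e| * s * P.mesh 0 * (P.d * ((P.L : ℝ) ^ k - 1))) * (2 + |C.e| * s * P.mesh 0 * (P.d * ((P.L : ℝ) ^ k - 1)))) :=
    mul_nonneg (mul_nonneg (abs_nonneg _) (pow_nonneg (inv_nonneg.2 hm) 2)) (mul_nonneg hmε0 (by linarith))
  have hω : P.mesh k * (|B1.aSeq a P.L k| * (P.mesh k)⁻¹ ^ 2 *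
      ((|C.e| * s * P.mesh 0 * (P.d * ((P.L : ℝ) ^ k - 1))) * (2 + |C.e| * s * P.mesh 0 * (P.d * ((P.L : ℝ) ^ k - 1)))))
      ≤ a * (((|C.e| * s) * P.d) * (2 + (|C.e| * s) * P.d)) := by
    have hmpos := P.mesh_pos k
    -- `L^kε·(L^kε)^{−2}·m_ε = (L^kε)^{−1}m_ε ≤ |e|sd`
    have h1 : P.mesh k * (|B1.aSeq a P.L k| * (P.mesh k)⁻¹ ^ 2 *
        ((|C.e| * s * P.mesh 0 * (P.d * ((P.L : ℝ) ^ k - 1))) * (2 + |C.e| * s * P.mesh 0 * (P.d * ((P.L : ℝ) ^ k - 1)))))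
        = |B1.aSeq a P.L k| * (((P.mesh k)⁻¹ * (|C.e| * s * P.mesh 0 * (P.d * ((P.L : ℝ) ^ k - 1)))) *
            (2 + |C.e| * s * P.mesh 0 * (P.d * ((P.L : ℝ) ^ k - 1)))) := by
      field_simp
    rw [h1]
    have h2 : (P.mesh k)⁻¹ * (|C.e| * s * P.mesh 0 * (P.d * ((P.L : ℝ) ^ k - 1))) ≤ |C.e| * s * P.d := by
      rw [inv_mul_le_iff₀ hmpos]; linarith
    have h3 : 2 + |C.e| * s * P.mesh 0 * (P.d * ((P.L : ℝ) ^ k - 1)) ≤ 2 + |C.e| * s * P.d := by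
      nlinarith [mul_nonneg (mul_nonneg hes hd) hm]
    have h20 : 0 ≤ (P.mesh k)⁻¹ * (|C.e| * s * P.mesh 0 * (P.d * ((P.L : ℝ) ^ k - 1))) := mul_nonneg (inv_nonneg.2 hm) hmε0
    have hY0 : 0 ≤ 2 + |C.e| * s * P.mesh 0 * (P.d * ((P.L : ℝ) ^ k - 1)) := by linarith
    exact mul_le_mul hak (mul_le_mul h2 h3 hY0 (mul_nonneg hes hd)) (mul_nonneg h20 hY0) ha.le
  -- signs of the dictionary slots
  have hc1 : 0 ≤ P.mesh 0 ^ P.d * C₁ := mul_nonneg hE.le hC₁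
  have hc2 : 0 ≤ P.mesh 0 ^ P.d * C₂ := mul_nonneg hE.le hC₂
  have hc4 : 0 ≤ P.mesh 0 ^ P.d * C₄ := mul_nonneg hE.le hC₄
  have hcd : 0 ≤ P.mesh 0 ^ P.d * C₁ + Real.exp 1 * (P.mesh 0 ^ P.d * C₁) * P.mesh k * (|C.e| * s) := by positivity
  have hcm : 0 ≤ P.mesh 0 ^ P.d * C₂ + Real.exp 1 * (P.mesh 0 ^ P.d * C₁) * P.mesh k * ((|C.e| * s) * (Fintype.card (Ix N) : ℝ)) := by
    positivity
  have hcN : 0 ≤ (Fintype.card (Ix N) : ℝ) * (P.mesh 0 ^ P.d * C₁) := mul_nonneg hNC hc1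
  have hκ₂ : 0 ≤ (P.mesh 0)⁻¹ * (|C.e| * δA) := by positivity
  have hes2 : 0 ≤ (|C.e| * s) ^ 2 := pow_nonneg hes 2
  have heτ : |C.e| * δA ≤ (P.L : ℝ) ^ k * (|C.e| * δA) := le_mul_of_one_le_left heδ hLk
  have hsm : 0 ≤ smoothConst P.d m c₁ (c₂ + 2 * c₁) := (smoothConst_pos P.d m hc₁ (by positivity)).le
  have hdm : (0 : ℝ) ≤ (P.d : ℝ) * (m : ℝ) := mul_nonneg hd hmn
  have e21 : (0 : ℝ) ≤ 1 + 1 - 2 := by norm_num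
  have e10 : (0 : ℝ) ≤ 0 + 1 - 1 := by norm_num
  have e1α : (0 : ℝ) ≤ 0 + 1 - (1 - α) := by linarith
  have two : (0 : ℝ) < 2 := by norm_num
  have k1 := inv_mul_collarC_le (N := N) hL hδ two hmesh e21 hc1 hc1 hc1 hcd q₁ q₁ q₁ qd hes le_rfl hes2 hes hκ₄0 hτ0 hω
  have k2 := inv_mul_collarC_le (N := N) hL hδ two hmesh e21 hc1 hcd hc1 hc1 q₁ qd q₁ q₁ hes le_rfl hes2 hes hκ₄0 hτ0 hω
  have k3 := inv_mul_collarC_le (N := N) hL hδ two hmesh e10 hc1 hc2 hc1 hcd q₁ q₂ q₁ qd hes le_rfl hes2 hes hκ₄0 hτ0 hω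
  have k4 := inv_mul_collarC_le (N := N) hL hδ two hmesh e10 hc1 hcm hc1 hc1 q₁ qm q₁ q₁ hes le_rfl hes2 hes hκ₄0 hτ0 hω
  have k7 := inv_mul_collarC_le (N := N) hL hδ two hmesh e1α hc4 le_rfl hc1 hcd q₄ q0 q₁ qd hes hκ₂ hes2 le_rfl hκ₄0 hτ hω
  have k8 := inv_mul_collarC_le (N := N) hL hδ two hmesh e1α hc4 le_rfl hc1 hc1 q₄ q0 q₁ q₁ hes hκ₂ hes2 le_rfl hκ₄0 hτ hω
  have k9 := inv_mul_collarC_le (N := N) hL hδ one_pos hmesh e10 hc1 hc2 hcN hcm q₁ q₂ qN qm hes le_rfl hes2 hes hκ₄0 hτ0 hω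
  have k10 := inv_mul_collarC_le (N := N) hL hδ one_pos hmesh e10 hc1 hcm hcN hc2 q₁ qm qN q₂ hes le_rfl hes2 hes hκ₄0 hτ0 hω
  have f1 := inv_mul_face_le (P := P) (es := |C.e| * s) nF hδ heτ hε1 hC₄ hC₁
  have key := combine hsm hdm k1 k2 k3 k4 k3 k4 k7 k8 k9 k10 f1 f1
  unfold collarK collarKU
  exact key

/-- **CURRENCY OF THE COLLAR MEMBERS' CONSTANT**: the constant `C_G + (ε^d)^{−1}·farF(δ,ρ)·collarK(…)` of the located collar members
(`B3Ineq25Op116ClassCSplit`, `B3Ineq25Op116CollarRegionHolder`) is bounded by the `ε`-FREE, `k`-FREE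
`C_G + farC₀(d,δ)·e^{−δρ/4}·collarKU(d, L, N, δ, a, C₁, C₂, C₄, |e|s, L^k|e|δ_A, n_F, m, c₁, c₂)` (`farF = farC₀·e^{−δρ/4}` definitionally).
[cite: Balaban1983Higgs3, Prop. 1 p.421 «independent of ε, k», (2.5) p.424, p.433] -/
theorem collar_bound_currency (hL : 1 < P.L) (C : ChargeData N) {k : ℕ} (hk : 1 ≤ k) {a δ α s δA C₁ C₂ C₄ c₁ c₂ : ℝ} (ha : 0 < a)
    (hδ : 0 < δ) (hα : 0 ≤ α) (hmesh : P.mesh k ≤ 1) (hs : 0 ≤ s) (hδA : 0 ≤ δA) (hC₁ : 0 ≤ C₁) (hC₂ : 0 ≤ C₂) (hC₄ : 0 ≤ C₄)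
    (hc₁ : 0 ≤ c₁) (hc₂ : 0 ≤ c₂) (nF m : ℕ) (CG ρ : ℝ) :
    CG + (P.mesh 0 ^ P.d)⁻¹ * farF P δ ρ * collarK P N C k a δ α s δA (P.mesh 0 ^ P.d * C₁) (P.mesh 0 ^ P.d * C₁) (P.mesh 0 ^ P.d * C₂)
        (P.mesh 0 ^ P.d * C₁) (P.mesh 0 ^ P.d * C₁) (P.mesh 0 ^ P.d * C₂) (P.mesh 0 ^ P.d * C₄) (P.mesh 0 ^ P.d * C₄) nF m c₁ c₂
      ≤ CG + farC₀ P.d δ * Real.exp (-(δ / 4 * ρ)) *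
          collarKU P.d (P.L : ℝ) N δ a C₁ C₂ C₄ (|C.e| * s) ((P.L : ℝ) ^ k * (|C.e| * δA)) nF m c₁ c₂ := by
  have h := collarK_currency hL C hk ha hδ hα hmesh hs hδA hC₁ hC₂ hC₄ hc₁ hc₂ nF m
  have hF : 0 ≤ farF P δ ρ := (farF_pos hδ ρ).le
  have e : ∀ X : ℝ, (P.mesh 0 ^ P.d)⁻¹ * farF P δ ρ * X = farF P δ ρ * ((P.mesh 0 ^ P.d)⁻¹ * X) := fun X => by ring
  rw [e]
  exact add_le_add le_rfl (mul_le_mul_of_nonneg_left h hF)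

end Main

end Literature.MathematicalPhysics.QuantumFieldTheory.Balaban1983to89.B3Op116CollarCurrency

end
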